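import Literature.Probability.Divergences.RenyiDivergence
import Literature.MathematicalPhysics.KineticTheory.HardSphereEulerProofs
import HarnessLib

/-!
# Crux `RestartPrinciple` (stmt-AtomisticToContinuum-12503), line `isentropic-regibbsification` —
# Rényi divergence from a Hellinger bound, and the log-likelihood of a local Gibbs density

Support file for the lead's reduction (R2) of the Rényi short-time local equilibrium to the one-sided
bet. Three elementary pieces:

* `renyiDiv_le_of_hellingerIntegral_le` — for `γ > 0`, `∫ (dμ/dν)^{1+γ} dν ≤ e^{γ b}` with `b ≥ 0` gives
  `D_{1+γ}(μ ‖ ν) ≤ b` (`D_{1+γ} = γ⁻¹ log ∫ (dμ/dν)^{1+γ} dν`);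
* `ofReal_mul_rpow_div_eq` — the pointwise identity behind the Liouville identity,
  `g · (f/g)^{1+γ} = f · e^{γ (log f − log g)}` in `ℝ≥0∞` for positive reals `f, g`;
* `log_canonicalDensity_eq` — on the hard-sphere domain the log-likelihood of a canonical density with a
  positive profile is `−log Z + Σᵢ log ψ(zᵢ)`.
-/

noncomputable section

open MeasureTheory Filter Set
open Literature.Probability.Divergences Literature.Analysis.FluidPDE Literature.MathematicalPhysics.KineticTheory
open scoped ENNReal

namespace Summit.AtomisticToContinuum.HydrodynamicLimit.Theorems.RestartPrinciple.IsentropicRegibbsification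

/-- **Rényi divergence from a Hellinger bound.** For an order `1 + γ`, `γ > 0`, and a real `b`:
if `∫ (dμ/dν)^{1+γ} dν ≤ e^{γ b}` then `D_{1+γ}(μ ‖ ν) ≤ b`. [cite: VanervenHarremoes2014, Def. 2] -/
theorem renyiDiv_le_of_hellingerIntegral_le {α : Type*} [MeasurableSpace α] {μ ν : Measure α} {γ b : ℝ}
    (hγ : 0 < γ) (hH : hellingerIntegral (1 + γ) μ ν ≤ ENNReal.ofReal (Real.exp (γ * b))) :
    renyiDiv (1 + γ) μ ν ≤ ENNReal.ofReal b := by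
  have hne1 : (1 + γ : ℝ) ≠ 1 := by intro h; linarith
  have hγ1 : (1 + γ : ℝ) - 1 = γ := by ring
  rw [renyiDiv_of_ne_one hne1, hγ1]
  -- `log H ≤ γ b`
  have hlog : ENNReal.log (hellingerIntegral (1 + γ) μ ν) ≤ ((γ * b : ℝ) : EReal) := by
    have h1 := ENNReal.log_monotone hH
    rwa [ENNReal.log_ofReal_of_pos (Real.exp_pos _), Real.log_exp] at h1
  -- multiply by `γ⁻¹ > 0` and take `toENNReal`
  have hγinv : (0 : EReal) ≤ ((γ⁻¹ : ℝ) : EReal) := by exact_mod_cast (inv_pos.2 hγ).le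
  have h2 : ((γ⁻¹ : ℝ) : EReal) * ENNReal.log (hellingerIntegral (1 + γ) μ ν) ≤
      ((γ⁻¹ : ℝ) : EReal) * ((γ * b : ℝ) : EReal) :=
    mul_le_mul_of_nonneg_left hlog hγinv
  have h3 : ((γ⁻¹ : ℝ) : EReal) * ((γ * b : ℝ) : EReal) = ((b : ℝ) : EReal) := by
    rw [← EReal.coe_mul]
    congr 1
    field_simp
  rw [h3] at h2
  calc (((γ⁻¹ : ℝ) : EReal) * ENNReal.log (hellingerIntegral (1 + γ) μ ν)).toENNReal
      ≤ (((b : ℝ) : EReal)).toENNReal := EReal.toENNReal_le_toENNReal h2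
    _ = ENNReal.ofReal b := EReal.real_coe_toENNReal b

/-- **The pointwise identity behind the Liouville identity**: for positive reals `f, g` and real `γ`,
`g · (f / g)^{1+γ} = f · e^{γ (log f − log g)}` in `ℝ≥0∞`. [folklore] -/
theorem ofReal_mul_rpow_div_eq {f g : ℝ} (γ : ℝ) (hf : 0 < f) (hg : 0 < g) :
    ENNReal.ofReal g * (ENNReal.ofReal f * (ENNReal.ofReal g)⁻¹) ^ (1 + γ) =
      ENNReal.ofReal f * ENNReal.ofReal (Real.exp (γ * (Real.log f - Real.log g))) := by
  have hfg : 0 < f / g := div_pos hf hg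
  rw [← ENNReal.ofReal_inv_of_pos hg, ← ENNReal.ofReal_mul hf.le, ← div_eq_mul_inv,
    ENNReal.ofReal_rpow_of_pos hfg, ← ENNReal.ofReal_mul hg.le, ← ENNReal.ofReal_mul hf.le]
  congr 1
  rw [Real.rpow_add hfg, Real.rpow_one, ← Real.log_div hf.ne' hg.ne',
    Real.rpow_def_of_pos hfg, mul_comm (Real.log (f / g)) γ]
  field_simp

/-- **Log-likelihood of a canonical density on the hard-sphere domain**: for a positive one-body profile
`ψ`, a positive partition function, and `z ∈ D_ε^N`,
`log (canonicalDensity G ε N ψ z) = −log Z + Σᵢ log ψ(zᵢ)`. [folklore] -/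
theorem log_canonicalDensity_eq {d : Type*} [Fintype d] {X : Type*} [MeasureSpace X] {G : Geometry d X}
    {ε : ℝ} {n : ℕ} {ψ : X × EuclideanSpace ℝ d → ℝ} (hψ : ∀ y, 0 < ψ y)
    (_hZ : 0 < canonicalPartition G ε n ψ) {z : Config n d X} (hz : z ∈ hardSphereDomain G n ε) :
    Real.log (canonicalDensity G ε n ψ z) =
      -Real.log (canonicalPartition G ε n ψ) + ∑ i, Real.log (ψ (z i)) := by
  rw [canonicalDensity, Set.indicator_of_mem hz, tensorPow,
    Real.log_mul (inv_ne_zero _hZ.ne') (Finset.prod_pos fun i _ => hψ (z i)).ne', Real.log_inv,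
    Real.log_prod]
  exact fun i _ => (hψ (z i)).ne'

/-- A canonical density with a positive profile and positive partition function is positive on the
hard-sphere domain. [folklore] -/
theorem canonicalDensity_pos_of_mem {d : Type*} [Fintype d] {X : Type*} [MeasureSpace X] {G : Geometry d X}
    {ε : ℝ} {n : ℕ} {ψ : X × EuclideanSpace ℝ d → ℝ} (hψ : ∀ y, 0 < ψ y)
    (hZ : 0 < canonicalPartition G ε n ψ) {z : Config n d X} (hz : z ∈ hardSphereDomain G n ε) :
    0 < canonicalDensity G ε n ψ z := by
  rw [canonicalDensity, Set.indicator_of_mem hz, tensorPow]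
  exact mul_pos (inv_pos.2 hZ) (Finset.prod_pos fun k _ => hψ _)

/-- **Bound on the negative log-profile of a local Gibbs state**: for a continuous positive activity `a`,
continuous `u` with `‖u‖ ≤ M`, and `θ ∈ [M⁻¹, M]` (`M ≥ 1`), there is a constant `C` with
`−log (localGibbsProfile a u θ (x, v)) ≤ C + M‖v‖²` for all `(x, v)`: the Maxwellian exponent is
`‖v − u(x)‖²/(2θ(x)) ≤ M(‖v‖² + M²)` and the prefactors are bounded on the compact torus. [folklore] -/
theorem exists_neg_log_localGibbsProfile_le {a θ : T3 → ℝ} {u : T3 → V3} (ha : Continuous a)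
    (ha0 : ∀ x, 0 < a x) {M : ℝ} (hM : 1 ≤ M) (hθM : ∀ x, θ x ≤ M) (hθm : ∀ x, M⁻¹ ≤ θ x)
    (huM : ∀ x, ‖u x‖ ≤ M) :
    ∃ C : ℝ, ∀ (x : T3) (v : V3), -Real.log (localGibbsProfile a u θ (x, v)) ≤ C + M * ‖v‖ ^ 2 := by
  have hM0 : 0 < M := lt_of_lt_of_le one_pos hM
  have hθ0 : ∀ x, 0 < θ x := fun x => lt_of_lt_of_le (inv_pos.2 hM0) (hθm x)
  -- a lower bound for `log a` on the compact torus
  obtain ⟨x₀, -, hx₀⟩ := isCompact_univ.exists_isMinOn univ_nonempty ha.continuousOn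
  have hamin : ∀ x, a x₀ ≤ a x := fun x => hx₀ (mem_univ x)
  refine ⟨-Real.log (a x₀) + 3 / 2 * Real.log (2 * Real.pi * M) + M * M ^ 2, fun x v => ?_⟩
  have hfin : Module.finrank ℝ V3 = 3 := by simp
  have hprof : localGibbsProfile a u θ (x, v) =
      a x * ((2 * Real.pi * θ x) ^ (-(3 : ℝ) / 2) * Real.exp (-‖v - u x‖ ^ 2 / (2 * θ x))) := by
    simp only [localGibbsProfile, localMaxwellian, hfin, one_mul]
    norm_num
  have h2πθ : 0 < 2 * Real.pi * θ x := mul_pos (mul_pos two_pos Real.pi_pos) (hθ0 x)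
  rw [hprof, Real.log_mul (ha0 x).ne' (mul_pos (Real.rpow_pos_of_pos h2πθ _) (Real.exp_pos _)).ne',
    Real.log_mul (Real.rpow_pos_of_pos h2πθ _).ne' (Real.exp_pos _).ne', Real.log_rpow h2πθ,
    Real.log_exp]
  -- the three pieces
  have h1 : -Real.log (a x) ≤ -Real.log (a x₀) :=
    neg_le_neg (Real.log_le_log (ha0 x₀) (hamin x))
  have h2 : -(-(3 : ℝ) / 2 * Real.log (2 * Real.pi * θ x)) ≤ 3 / 2 * Real.log (2 * Real.pi * M) := by
    have : Real.log (2 * Real.pi * θ x) ≤ Real.log (2 * Real.pi * M) :=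
      Real.log_le_log h2πθ (mul_le_mul_of_nonneg_left (hθM x) (mul_pos two_pos Real.pi_pos).le)
    linarith
  have h3 : -(-‖v - u x‖ ^ 2 / (2 * θ x)) ≤ M * M ^ 2 + M * ‖v‖ ^ 2 := by
    rw [neg_div, neg_neg, div_le_iff₀ (mul_pos two_pos (hθ0 x))]
    have hvu : ‖v - u x‖ ^ 2 ≤ 2 * ‖v‖ ^ 2 + 2 * ‖u x‖ ^ 2 := by
      have := norm_sub_le v (u x)
      nlinarith [norm_nonneg v, norm_nonneg (u x), norm_nonneg (v - u x), sq_nonneg (‖v‖ - ‖u x‖)]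
    have hu2 : ‖u x‖ ^ 2 ≤ M ^ 2 := pow_le_pow_left₀ (norm_nonneg _) (huM x) 2
    have hθinv : 1 ≤ M * θ x := by
      have := mul_le_mul_of_nonneg_left (hθm x) hM0.le
      rwa [mul_inv_cancel₀ hM0.ne'] at this
    nlinarith [sq_nonneg ‖v‖, hθ0 x, sq_nonneg M]
  linarith

end Summit.AtomisticToContinuum.HydrodynamicLimit.Theorems.RestartPrinciple.IsentropicRegibbsification

end
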